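import Mathlib.LinearAlgebra.Matrix.SpecialLinearGroup
import Mathlib.Tactic
import HarnessLib

/-!
# The Popa–Zagier Hecke element `T̃_n ∈ ℚ[M_n]` (explicit form): definitions

Source: A. A. Popa, D. Zagier, *An elementary proof of the Eichler–Selberg trace formula*,
J. reine angew. Math. **762** (2020) 105–122 = arXiv:1711.00327 [PopaZagier2017], §4, formula
(13) (held: `paper:arxiv-1711.00327`, chunks 9–10), and Lemma 4 / Theorem 4 there.

For `n ≥ 1` let `M_n` be the set of integral `2 × 2` matrices of determinant `n` taken modulo
`{±1}`, `R_n = ℚ[M_n]`, `Γ = PSL₂(ℤ) = ⟨S, U⟩`, `S = (0 -1; 1 0)`, `U = (1 -1; 1 0)` (`U = TS`,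
`T = (1 1; 0 1)`, `S² = U³ = 1`). Popa–Zagier construct ONE element
`T̃ = ∑_n T̃_n ∈ ∏_n R_n` which simultaneously

* (A) acts as the `n`-th Hecke operator on period polynomials / modular symbols of every level:
  `(1 - S) T̃_n - T_n^∞ (1 - S) ∈ (1 - T) R_n`;
* (B) swaps the two relation subspaces: `T̃_n (1 + S) ∈ (1 + U + U²) R_n` and
  `T̃_n (1 + U + U²) ∈ (1 + S) R_n`;
* (C) has prescribed sums over `Γ`-conjugacy classes `X ⊂ M_n`: `∑_{M ∈ X} c(M) = ε(X)`
  (`-1/|Γ_M|` for elliptic `X`, `+1` for split hyperbolic, `0` for non-split hyperbolic and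
  parabolic, `1/6` for scalar `X`),

and (A)–(C) give the Eichler–Selberg trace formula by pure linear algebra (loc. cit. §2; for
congruence subgroups A. Popa, Proc. AMS **146** (2018) 2749–2764 = arXiv:1408.4998 [Popa2014]).
After the simplification of loc. cit. Lemma 4(b) the element is, with the bracket notation
`⟨first line | second line⟩` of loc. cit. (a sum of matrices `(a b; c d)` satisfying the
inequalities, weighted `1`, `½`, `¼`, `⅓`, `⅙` according to the equalities on the first line),

  `T̃ = ⟨a-d ≤ -b ≤ c | 0 ≤ c < a⟩ - ⟨-b ≤ a-d ≤ c | b < d ≤ 0⟩`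
      `- ⟨0 ≤ a-d ≤ c ≤ -b | a ≤ 0 < c⟩ - ⟨0 ≤ a-d ≤ -b ≤ c | d ≤ 0 < -b⟩`          (13)

(representatives modulo `±1` are taken with non-negative lower-left entry).

## This file (definitions only; the companion `…Proofs` files prove the properties)

Everything is stated for `12 ×` the coefficients, so that all weights are INTEGERS
(`12, 6, 4, 3, 2`) and the verifications are decidable linear integer arithmetic:

* `chainWeight3 x y z`, `chainWeight4 x y z w` — `12 ×` the weight of a nested chain
  `x ≤ y ≤ z (≤ w)` (`12`; `6` with one equality; `2` for two adjacent equalities `x = y = z`;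
  `3` for the two non-adjacent equalities `x = y`, `z = w`);
* `pz13 a b c d` — `12 ×` the coefficient of the SIGN-NORMALISED matrix `(a b; c d)` in (13);
* `coeff12 a b c d` — `12 ×` the coefficient of `±(a b; c d)` (either sign), and
  `coeff M : ℚ` for an integral matrix `M` (`= coeff12 / 12`);
* the five bracket families `wE, wH, wX, wY, wZ` of loc. cit. (12) (`E` = elliptic
  representatives weighted by the fundamental domain `𝓕 = {0 ≤ Re z ≤ ½, |z - 1| ≥ 1}`,
  `H` = split-hyperbolic and scalar representatives, `X, Y, Z` the correction terms) and
  `coeff12' = -E + H + X - SXS + Y - U²YU + Z - U²ZU`, the form (12) of the same element, in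
  which property (C) is visible;
* (in the companion files `PopaZagierHeckeElement…Cases…`, `PopaZagierHeckeElementProofs`) the
  theorems `propB1`, `propB2` (property (B), coefficientwise: `c + c(·S)` is left `U`-invariant
  and `c + c(·U) + c(·U²)` is left `S`-invariant), `propDecomp` ((12) = (13)) and `propT2`
  (`T₂ = T₁ U`, used for the coset sums of loc. cit. Thm. 4(b)).

Numerical transcription checks (session evidence `scratch/pz/*.py`): (B1), (B2), (12) = (13)
hold for all `(a, b, c, d) ∈ [-8, 8]⁴`; the total coefficient sum is `-σ₁(n)` and the sums over
elliptic conjugacy classes are `-1/|Γ_M|` for `n ≤ 9`; and the resulting weight-`2` trace formula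
reproduces `tr T_n | S₂(Γ₀(N))` for 50 pairs `(N, n)`, `N ≤ 37`.

## References

* [PopaZagier2017] A. A. Popa, D. Zagier, J. reine angew. Math. 762 (2020), §1 (A)–(C), Thm. 1;
  §4 (12), (13), Lemma 4, Thm. 4.
* [Popa2014] A. A. Popa, Proc. Amer. Math. Soc. 146 (2018), §2 (Prop. 2.1, Thm. 2.1).
-/

namespace Literature.NumberTheory.Automorphic.PopaZagier

/-! ### Integer weights of chains of inequalities -/

/-- `12 ×` the Popa–Zagier weight of a nested chain `x ≤ y ≤ z`: `1` if both inequalities are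
strict, `½` if exactly one is an equality, `⅙` if `x = y = z`; `0` if the chain fails.
[cite: PopaZagier2017, §4 (definition of the coefficient c(M))] -/
def chainWeight3 (x y z : ℤ) : ℤ :=
  if x ≤ y ∧ y ≤ z then (if x = y then (if y = z then 2 else 6) else (if y = z then 6 else 12))
  else 0

/-- `12 ×` the Popa–Zagier weight of a nested chain `x ≤ y ≤ z ≤ w`: `1` (all strict), `½`
(one equality), `⅙` (two adjacent equalities), `¼` (the two non-adjacent equalities `x = y`,
`z = w`), and `1/12` for `x = y = z = w` (a case that never occurs below); `0` if the chain fails.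
[cite: PopaZagier2017, §4 (definition of the coefficient c(M))] -/
def chainWeight4 (x y z w : ℤ) : ℤ :=
  if x ≤ y ∧ y ≤ z ∧ z ≤ w then
    (if x = y then (if y = z then (if z = w then 1 else 2) else (if z = w then 3 else 6))
     else (if y = z then (if z = w then 2 else 6) else (if z = w then 6 else 12)))
  else 0

/-! ### The element (13) -/

/-- `12 ×` the coefficient of the sign-normalised matrix `(a b; c d)` (i.e. `c > 0`, or `c = 0`
and `a > 0`) in the Popa–Zagier element, formula (13) of [PopaZagier2017]:
`T̃ = ⟨a-d ≤ -b ≤ c | 0 ≤ c < a⟩ - ⟨-b ≤ a-d ≤ c | b < d ≤ 0⟩ - ⟨0 ≤ a-d ≤ c ≤ -b | a ≤ 0 < c⟩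
 - ⟨0 ≤ a-d ≤ -b ≤ c | d ≤ 0 < -b⟩`. [cite: PopaZagier2017, §4 (13)] -/
def pz13 (a b c d : ℤ) : ℤ :=
  (if 0 ≤ c ∧ c < a then chainWeight3 (a - d) (-b) c else 0)
  - (if b < d ∧ d ≤ 0 then chainWeight3 (-b) (a - d) c else 0)
  - (if a ≤ 0 ∧ 0 < c then chainWeight4 0 (a - d) c (-b) else 0)
  - (if d ≤ 0 ∧ 0 < -b then chainWeight4 0 (a - d) (-b) c else 0)

/-- `12 ×` the coefficient of `±(a b; c d)` in `T̃` (elements of `M_n` are matrices modulo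
`±1`; the representative with non-negative lower-left entry is used, [PopaZagier2017] §4).
[cite: PopaZagier2017, §4 (13)] -/
def coeff12 (a b c d : ℤ) : ℤ :=
  if 0 < c ∨ (c = 0 ∧ 0 < a) then pz13 a b c d else pz13 (-a) (-b) (-c) (-d)

/-- `12 ×` the coefficient of the integral matrix `M` in `T̃`. [cite: PopaZagier2017, §4 (13)] -/
def coeff12M (M : Matrix (Fin 2) (Fin 2) ℤ) : ℤ := coeff12 (M 0 0) (M 0 1) (M 1 0) (M 1 1)

/-- The coefficient `c(M) ∈ ℚ` of the integral matrix `M` in the Popa–Zagier element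
`T̃ = ∑ c(M) M` (so `T̃_n` is its restriction to `det M = n`). [cite: PopaZagier2017, §4 (13)] -/
def coeff (M : Matrix (Fin 2) (Fin 2) ℤ) : ℚ := (coeff12M M : ℚ) / 12

/-- The first bracket of (13), `T₁ = ⟨a-d ≤ -b ≤ c | 0 ≤ c < a⟩` (`12 ×` coefficient of the
sign-normalised matrix). [cite: PopaZagier2017, §4 (13)] -/
def wT1 (a b c d : ℤ) : ℤ := if 0 ≤ c ∧ c < a then chainWeight3 (a - d) (-b) c else 0

/-- The second bracket of (13), `T₂ = ⟨-b ≤ a-d ≤ c | b < d ≤ 0⟩`. [cite: PopaZagier2017, §4 (13)] -/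
def wT2 (a b c d : ℤ) : ℤ := if b < d ∧ d ≤ 0 then chainWeight3 (-b) (a - d) c else 0

/-- The third bracket of (13), `T₃ = ⟨0 ≤ a-d ≤ c ≤ -b | a ≤ 0 < c⟩`. [cite: PopaZagier2017, §4 (13)] -/
def wT3 (a b c d : ℤ) : ℤ := if a ≤ 0 ∧ 0 < c then chainWeight4 0 (a - d) c (-b) else 0

/-- The fourth bracket of (13), `T₄ = ⟨0 ≤ a-d ≤ -b ≤ c | d ≤ 0 < -b⟩`. [cite: PopaZagier2017, §4 (13)] -/
def wT4 (a b c d : ℤ) : ℤ := if d ≤ 0 ∧ 0 < -b then chainWeight4 0 (a - d) (-b) c else 0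

/-- (13) termwise: `pz13 = T₁ - T₂ - T₃ - T₄`. [cite: PopaZagier2017, §4 (13)] -/
theorem pz13_eq (a b c d : ℤ) : pz13 a b c d = wT1 a b c d - wT2 a b c d - wT3 a b c d - wT4 a b c d :=
  rfl

/-! ### The element (12): `T̃ = -E + H + X - SXS + Y - U²YU + Z - U²ZU` -/

/-- `12 ×` the weight `χ(z_M)` of the elliptic representative `M = (a b; c d)`, `b < 0 < c`, with
fixed point `z_M` in the fundamental domain `𝓕 = {0 ≤ Re z ≤ ½, |z - 1| ≥ 1}` of `PSL₂(ℤ)`: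
`E = ⟨0 ≤ a-d ≤ -b; a-d ≤ c | b < 0 < c⟩`, i.e. the conditions `0 ≤ a - d` (`Re z_M ≥ 0`),
`a - d ≤ c` (`Re z_M ≤ ½`), `a - d ≤ -b` (`|z_M - 1| ≥ 1`), weighted by the angle `𝓕` subtends
at `z_M`: `1` inside, `½` on an edge, `⅓` at the corner `ρ` (`a - d = -b = c`), `⅙` at the two
ideal corners. [cite: PopaZagier2017, §4 (12) and Figure 1] -/
def wE (a b c d : ℤ) : ℤ :=
  if b < 0 ∧ 0 < c ∧ 0 ≤ a - d ∧ a - d ≤ -b ∧ a - d ≤ c then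
    (if 0 = a - d then (if a - d = -b then 2 else if a - d = c then 2 else 6)
     else if a - d = -b then (if a - d = c then 4 else 6)
     else if a - d = c then 6 else 12)
  else 0

/-- `12 ×` the weight of the split-hyperbolic / scalar representative:
`H = ⟨a-d ≤ -b ≤ c | c = 0 < a⟩` (upper triangular matrices `(a b; 0 d)`, `a ≤ d`,
`0 ≤ -b ≤ 0`… i.e. `a - d ≤ -b ≤ 0`, end points weighted `½`, the scalar matrix `⅙`).
[cite: PopaZagier2017, §4 (12)] -/
def wH (a b c d : ℤ) : ℤ := if c = 0 ∧ 0 < a then chainWeight3 (a - d) (-b) c else 0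

/-- `12 ×` the weight in `X = ⟨0 ≤ a-d; -b ≤ c | b < 0 < d⟩` (two independent inequalities:
`1`, `½`, `¼`). [cite: PopaZagier2017, §4 (12)] -/
def wX (a b c d : ℤ) : ℤ :=
  if b < 0 ∧ 0 < d ∧ 0 ≤ a - d ∧ -b ≤ c then
    (if 0 = a - d then (if -b = c then 3 else 6) else (if -b = c then 6 else 12))
  else 0

/-- `12 ×` the weight in `Y = ⟨a-d ≤ -b ≤ c | 0 < c < a⟩`. [cite: PopaZagier2017, §4 (12)] -/
def wY (a b c d : ℤ) : ℤ := if 0 < c ∧ c < a then chainWeight3 (a - d) (-b) c else 0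

/-- `12 ×` the weight in `Z = ⟨a-d ≤ c ≤ -b | 0 < a; 0 < c⟩`. [cite: PopaZagier2017, §4 (12)] -/
def wZ (a b c d : ℤ) : ℤ := if 0 < a ∧ 0 < c then chainWeight3 (a - d) c (-b) else 0

/-- Sign normalisation of a bracket weight: evaluate `w` at the representative of `±(a b; c d)`
with non-negative lower-left entry (and positive upper-left entry if the lower-left one
vanishes). [cite: PopaZagier2017, §4 ("we always choose representatives with non-negative lower left entry")] -/
def sgnNorm (w : ℤ → ℤ → ℤ → ℤ → ℤ) (a b c d : ℤ) : ℤ :=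
  if 0 < c ∨ (c = 0 ∧ 0 < a) then w a b c d else w (-a) (-b) (-c) (-d)

/-- `12 ×` the coefficient of `±(a b; c d)` in the form (12) of the Popa–Zagier element,
`T̃ = -E + H + X - SXS + Y - U²YU + Z - U²ZU`: the coefficient of `M` in `SXS` is that of
`SMS` in `X` (`S⁻¹ = S` in `PSL₂(ℤ)`), and the coefficient of `M` in `U²YU` is that of
`U M U²` in `Y` (`U⁻¹ = U²`); here `SMS = (-d c; b -a)` and `UMU² = (b-d, d-b+c-a; b, -a-b)` for
`M = (a b; c d)`, `S = (0 -1; 1 0)`, `U = (1 -1; 1 0)`. [cite: PopaZagier2017, §4 (12)] -/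
def coeff12' (a b c d : ℤ) : ℤ :=
  - sgnNorm wE a b c d + sgnNorm wH a b c d
  + sgnNorm wX a b c d - sgnNorm wX (-d) c b (-a)
  + sgnNorm wY a b c d - sgnNorm wY (b - d) (d - b + c - a) b (-a - b)
  + sgnNorm wZ a b c d - sgnNorm wZ (b - d) (d - b + c - a) b (-a - b)

/-! ### Elementary unfoldings -/

/-- `coeff12M` on an explicit matrix. [folklore] -/
@[simp] theorem coeff12M_of (a b c d : ℤ) : coeff12M !![a, b; c, d] = coeff12 a b c d := by
  simp [coeff12M]

/-- `coeff` on an explicit matrix. [folklore] -/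
theorem coeff_of (a b c d : ℤ) : coeff !![a, b; c, d] = (coeff12 a b c d : ℚ) / 12 := by
  simp [coeff]

/-- `coeff12 = sgnNorm pz13`. [folklore] -/
theorem coeff12_eq_sgnNorm (a b c d : ℤ) : coeff12 a b c d = sgnNorm pz13 a b c d := rfl

end Literature.NumberTheory.Automorphic.PopaZagier
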